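import Mathlib
import Summits.Ventures.PercRepro2.TypedCountPendant
import Summits.Ventures.PercRepro2.TypedCountLeaf

/-!
# The bridge identity for the typed point-split count
(blind cell PercRepro2, night-3 g26, 2026-08-29; `proofs/NIGHT3-CERT.md` §35.6)

Let `e₀ = {u, w}` be a bridge separating the source side (edges `S₁` inside `V₁ ∋ s, u`) from the
side of `v` (edges `S₂` inside `V₁ᶜ ∋ w, v`).  With `e₀` blue the weight `[v ∈ C_s]` vanishes; with
`e₀` red the cluster of `s` is `C¹_s(ω₁) ∪ [u ∈ C¹_s(ω₁)]·C²_w(ω₂)` and the blue cluster is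
`C¹_s(ω̄₁)`, so for every colouring `ω₂` of the far side with `v ∈ Y := C²_w(ω₂)` the near-side sum
is the typed count of the **leaf graph** `S₁ ∪ {e₀}` (the leaf `w` at `u`, weight vertex `w`) with
the leaf functionals `star w F Y` of `TypedCountLeaf.lean`:

* **`typedCount_bridge`** — `T(S₁ ∪ {e₀} ∪ S₂; s, v; F, G) = Σ_{ω₂ ≤ 1_{S₂} : v ∈ C²_w(ω₂)}
  T(S₁ ∪ {e₀}; s, w; F*_{Y}, G*_{Y})`, an exact identity.

Together with the pendant-block reduction (`TypedCountPendant.lean`) this reduces `T ≥ 0` to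
`s–v` chains of 2-connected blocks.  Own work; standard axioms.
-/

namespace Summit.Ventures.PercRepro2

namespace TypedDeletion

variable {V : Type*} {E : Type*}

/-! ## The bridge identity -/

section Bridge

open Classical

variable [Fintype E] [DecidableEq E] {R : Type*} [CommRing R]

omit [Fintype E] in
/-- The complement within `{e₀}` of `one e₀` is the empty configuration. -/
lemma flipOn_singleton_one (e₀ : E) : flipOn ({e₀} : Finset E) (one e₀) = fun _ => false := by
  funext e
  simp only [flipOn_apply, one]
  by_cases he : e = e₀ <;> simp [he]

omit [Fintype E] in
/-- The complement within `{e₀}` of the empty configuration is `one e₀`. -/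
lemma flipOn_singleton_zero (e₀ : E) : flipOn ({e₀} : Finset E) (fun _ => false) = one e₀ := by
  funext e
  simp only [flipOn_apply, one]
  by_cases he : e = e₀ <;> simp [he]

omit [Fintype E] [DecidableEq E] in
/-- `0 ⊔ ω = ω`. -/
lemma join_zero_left (ω : Config E) : join (fun _ => false) ω = ω := by
  funext e; simp [join_apply]

omit [Fintype E] [DecidableEq E] in
/-- A vertex of `V₁` is isolated in a configuration whose open edges avoid `V₁`. -/
lemma cluster_far_eq_singleton {ends : E → Sym2 V} {V₁ : Set V} {u : V} (hu : u ∈ V₁)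
    {S₂ : Finset E} (h₂ : ∀ e ∈ S₂, ∀ x ∈ ends e, x ∉ V₁) {ω₂ : Config E} (hω₂ : OnS S₂ ω₂) :
    cluster ends ω₂ u = {u} := by
  apply Set.Subset.antisymm
  · refine cluster_subset_of_closed rfl ?_
    intro e x y he hxy hx
    rw [Set.mem_singleton_iff] at hx
    subst hx
    exact absurd hu (h₂ e (hω₂ e he) x (by rw [hxy]; exact Sym2.mem_mk_left x y))
  · intro x hx
    rw [Set.mem_singleton_iff] at hx
    subst hx
    exact mem_cluster_self _ _ _

omit [Fintype E] in
/-- The cluster of `u` under `one e₀ ⊔ ω₂` (`ends e₀ = {u, w}`, `ω₂` on the far side) is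
`{u, w} ∪ C_w(ω₂)`. -/
lemma cluster_join_one_far {ends : E → Sym2 V} {V₁ : Set V} {u w : V} (hu : u ∈ V₁) (hw : w ∉ V₁)
    {S₂ : Finset E} {e₀ : E} (he₀ : ends e₀ = s(u, w)) (h₂ : ∀ e ∈ S₂, ∀ x ∈ ends e, x ∉ V₁)
    {ω₂ : Config E} (hω₂ : OnS S₂ ω₂) :
    cluster ends (join (one e₀) ω₂) u = {u, w} ∪ cluster ends ω₂ w := by
  have h₁' : ∀ e ∈ ({e₀} : Finset E), ∀ x ∈ ends e, x ∈ ({u, w} : Set V) := by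
    intro e he x hx
    rw [Finset.mem_singleton] at he
    subst he
    rw [he₀, Sym2.mem_iff] at hx
    rcases hx with rfl | rfl
    · exact Set.mem_insert _ _
    · exact Set.mem_insert_of_mem _ rfl
  have h₂' : ∀ e ∈ S₂, ∀ x ∈ ends e, x ∉ ({u, w} : Set V) ∨ x = w := by
    intro e he x hx
    by_cases hxw : x = w
    · exact Or.inr hxw
    · left
      intro hx'
      rcases hx' with rfl | hx'
      · exact h₂ e he x hx hu
      · exact hxw hx'
  rw [cluster_join_pendant (V₁ := ({u, w} : Set V)) (s := u) (u := w) (Set.mem_insert u _)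
    (Set.mem_insert_of_mem _ rfl) h₁' h₂' (onS_one e₀) hω₂, cluster_one he₀,
    if_pos (show w ∈ ({u, w} : Set V) from Set.mem_insert_of_mem u rfl)]

/-- **The bridge identity.** For a bridge `e₀ = {u, w}` separating the source side (`S₁` inside
`V₁ ∋ s, u`) from the side of `v` (`S₂` inside `V₁ᶜ ∋ w, v`):
`T(S₁ ∪ {e₀} ∪ S₂; s, v; F, G) = Σ_{ω₂ ≤ 1_{S₂} : v ∈ C_w(ω₂)} T(S₁ ∪ {e₀}; s, w; F*, G*)`
with the leaf functionals `F* = star w F (C_w(ω₂))`. -/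
theorem typedCount_bridge (ends : E → Sym2 V) {V₁ : Set V} {s u w v : V} (hs : s ∈ V₁)
    (hu : u ∈ V₁) (hw : w ∉ V₁) (hv : v ∉ V₁) {S₁ S₂ : Finset E} {e₀ : E} (hd : Disjoint S₁ S₂)
    (he₁ : e₀ ∉ S₁) (he₂ : e₀ ∉ S₂) (he₀ : ends e₀ = s(u, w))
    (h₁ : ∀ e ∈ S₁, ∀ x ∈ ends e, x ∈ V₁) (h₂ : ∀ e ∈ S₂, ∀ x ∈ ends e, x ∉ V₁)
    (F G : Set V → R) :
    typedCount ends s v F G (S₁ ∪ ({e₀} ∪ S₂)) ∅ =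
      ∑ ω₂ : Config E, (if OnS S₂ ω₂ ∧ v ∈ cluster ends ω₂ w then
        typedCount ends s w (star w F (cluster ends ω₂ w)) (star w G (cluster ends ω₂ w))
          (S₁ ∪ {e₀}) ∅ else 0) := by
  -- disjointness bookkeeping
  have hd1 : Disjoint S₁ ({e₀} ∪ S₂) := by
    rw [Finset.disjoint_union_right]
    exact ⟨Finset.disjoint_singleton_right.2 he₁, hd⟩
  have hd2 : Disjoint ({e₀} : Finset E) S₂ := Finset.disjoint_singleton_left.2 he₂
  have hd3 : Disjoint S₁ ({e₀} : Finset E) := Finset.disjoint_singleton_right.2 he₁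
  -- the pendant part `{e₀} ∪ S₂` lies inside `V₁ᶜ ∪ {u}`
  have h₂' : ∀ e ∈ ({e₀} ∪ S₂ : Finset E), ∀ x ∈ ends e, x ∉ V₁ ∨ x = u := by
    intro e he x hx
    rw [Finset.mem_union, Finset.mem_singleton] at he
    rcases he with rfl | he
    · rw [he₀, Sym2.mem_iff] at hx
      rcases hx with rfl | rfl
      · exact Or.inr rfl
      · exact Or.inl hw
    · exact Or.inl (h₂ e he x hx)
  have h₂'' : ∀ e ∈ ({e₀} : Finset E), ∀ x ∈ ends e, x ∉ V₁ ∨ x = u := by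
    intro e he x hx
    exact h₂' e (Finset.mem_union_left _ he) x hx
  have h0 : OnS ({e₀} : Finset E) (fun _ : E => false) := fun e he => by simp at he
  -- the common double sum
  let core : Config E → Config E → R := fun ω₁ ω₂ =>
    if u ∈ cluster ends ω₁ s ∧ v ∈ cluster ends ω₂ w then
      (F (cluster ends ω₁ s ∪ cluster ends ω₂ w) - F (cluster ends (flipOn S₁ ω₁) s)) *
        (G (cluster ends ω₁ s ∪ cluster ends ω₂ w) - G (cluster ends (flipOn S₁ ω₁) s)) else 0
  -- LEFT: the far side summed inside
  have hL : typedCount ends s v F G (S₁ ∪ ({e₀} ∪ S₂)) ∅ =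
      ∑ ω₁ : Config E, (if OnS S₁ ω₁ then
        ∑ ω₂ : Config E, (if OnS S₂ ω₂ then core ω₁ ω₂ else 0) else 0) := by
    unfold typedCount
    simp only [withC_empty]
    have hsum := sum_onS_union hd1 (fun ω => wt ends s v ω *
      dlt F G (cluster ends ω s) (cluster ends (flipOn (S₁ ∪ ({e₀} ∪ S₂)) ω) s))
    rw [hsum]
    refine Finset.sum_congr rfl fun ω₁ _ => ?_
    by_cases hω₁ : OnS S₁ ω₁
    · rw [if_pos hω₁, if_pos hω₁]
      have hsum2 := sum_onS_union hd2 (fun ω₂' => wt ends s v (join ω₁ ω₂') *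
        dlt F G (cluster ends (join ω₁ ω₂') s)
          (cluster ends (flipOn (S₁ ∪ ({e₀} ∪ S₂)) (join ω₁ ω₂')) s))
      rw [hsum2, sum_onS_singleton, ← Finset.sum_add_distrib]
      refine Finset.sum_congr rfl fun ω₂ _ => ?_
      by_cases hω₂ : OnS S₂ ω₂
      · rw [if_pos hω₂, if_pos hω₂, if_pos hω₂]
        have hY₁ : OnS S₁ (flipOn S₁ ω₁) := onS_flipOn S₁ ω₁
        have hj1 : OnS ({e₀} ∪ S₂) (join (one e₀) ω₂) := onS_join (onS_one e₀) hω₂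
        have hj0 : OnS ({e₀} ∪ S₂) (join (fun _ => false) ω₂) := onS_join h0 hω₂
        have hC₁ : cluster ends ω₁ s ⊆ V₁ :=
          cluster_subset_of_edges_in hs fun e he x hx => h₁ e (hω₁ e he) x hx
        have hvR : v ∉ cluster ends ω₁ s := fun h => hv (hC₁ h)
        have hwY : w ∈ cluster ends ω₂ w := mem_cluster_self _ _ _
        have hred1 : cluster ends (join ω₁ (join (one e₀) ω₂)) s =
            cluster ends ω₁ s ∪ (if u ∈ cluster ends ω₁ s then
              {u, w} ∪ cluster ends ω₂ w else ∅) := by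
          rw [cluster_join_pendant hs hu h₁ h₂' hω₁ hj1, cluster_join_one_far hu hw he₀ h₂ hω₂]
        have hred0 : cluster ends (join ω₁ (join (fun _ => false) ω₂)) s = cluster ends ω₁ s := by
          rw [cluster_join_pendant hs hu h₁ h₂' hω₁ hj0, join_zero_left,
            cluster_far_eq_singleton hu h₂ hω₂]
          by_cases huR : u ∈ cluster ends ω₁ s
          · rw [if_pos huR]
            exact Set.union_eq_self_of_subset_right (Set.singleton_subset_iff.2 huR)
          · rw [if_neg huR, Set.union_empty]
        have hblue1 : cluster ends (flipOn (S₁ ∪ ({e₀} ∪ S₂)) (join ω₁ (join (one e₀) ω₂))) s =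
            cluster ends (flipOn S₁ ω₁) s := by
          rw [flipOn_union_join hd1 hω₁ hj1, flipOn_union_join hd2 (onS_one e₀) hω₂,
            flipOn_singleton_one,
            cluster_join_pendant hs hu h₁ h₂' hY₁ (onS_join h0 (onS_flipOn S₂ ω₂)),
            join_zero_left, cluster_far_eq_singleton hu h₂ (onS_flipOn S₂ ω₂)]
          by_cases huB : u ∈ cluster ends (flipOn S₁ ω₁) s
          · rw [if_pos huB]
            exact Set.union_eq_self_of_subset_right (Set.singleton_subset_iff.2 huB)
          · rw [if_neg huB, Set.union_empty]
        -- the closed term vanishes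
        have hnot0 : v ∉ cluster ends (join ω₁ (join (fun _ => false) ω₂)) s := by
          rw [hred0]; exact hvR
        have hterm0 : (wt ends s v (join ω₁ (join (fun _ => false) ω₂)) : R) = 0 := by
          unfold wt; rw [if_neg hnot0]
        rw [hterm0, zero_mul, add_zero]
        -- the open term
        simp only [core]
        by_cases huR : u ∈ cluster ends ω₁ s
        · rw [if_pos huR] at hred1
          have hset : cluster ends ω₁ s ∪ ({u, w} ∪ cluster ends ω₂ w) =
              cluster ends ω₁ s ∪ cluster ends ω₂ w := by
            ext x
            simp only [Set.mem_union, Set.mem_insert_iff, Set.mem_singleton_iff]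
            constructor
            · rintro (hx | (rfl | rfl) | hx)
              · exact Or.inl hx
              · exact Or.inl huR
              · exact Or.inr hwY
              · exact Or.inr hx
            · rintro (hx | hx)
              · exact Or.inl hx
              · exact Or.inr (Or.inr hx)
          rw [hset] at hred1
          rw [hred1, hblue1]
          by_cases hvY : v ∈ cluster ends ω₂ w
          · rw [if_pos ⟨huR, hvY⟩]
            have hmem : v ∈ cluster ends (join ω₁ (join (one e₀) ω₂)) s := by
              rw [hred1]; exact Or.inr hvY
            have hwt : (wt ends s v (join ω₁ (join (one e₀) ω₂)) : R) = 1 := by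
              unfold wt; rw [if_pos hmem]
            rw [hwt, one_mul]
            rfl
          · rw [if_neg (fun h => hvY h.2)]
            have hmem : v ∉ cluster ends (join ω₁ (join (one e₀) ω₂)) s := by
              rw [hred1]
              rintro (h | h)
              · exact hvR h
              · exact hvY h
            have hwt : (wt ends s v (join ω₁ (join (one e₀) ω₂)) : R) = 0 := by
              unfold wt; rw [if_neg hmem]
            rw [hwt, zero_mul]
        · rw [if_neg (fun h => huR h.1)]
          rw [if_neg huR, Set.union_empty] at hred1
          have hmem : v ∉ cluster ends (join ω₁ (join (one e₀) ω₂)) s := by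
            rw [hred1]; exact hvR
          have hwt : (wt ends s v (join ω₁ (join (one e₀) ω₂)) : R) = 0 := by
            unfold wt; rw [if_neg hmem]
          rw [hwt, zero_mul]
      · rw [if_neg hω₂, if_neg hω₂, if_neg hω₂, add_zero]
    · rw [if_neg hω₁, if_neg hω₁]
  -- RIGHT: the leaf count, expanded
  have hR : ∑ ω₂ : Config E, (if OnS S₂ ω₂ ∧ v ∈ cluster ends ω₂ w then
      typedCount ends s w (star w F (cluster ends ω₂ w)) (star w G (cluster ends ω₂ w))
        (S₁ ∪ {e₀}) ∅ else 0) =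
      ∑ ω₂ : Config E, (if OnS S₂ ω₂ then
        ∑ ω₁ : Config E, (if OnS S₁ ω₁ then core ω₁ ω₂ else 0) else 0) := by
    refine Finset.sum_congr rfl fun ω₂ _ => ?_
    by_cases hω₂ : OnS S₂ ω₂
    · rw [if_pos hω₂]
      have hwY : w ∈ cluster ends ω₂ w := mem_cluster_self _ _ _
      by_cases hvY : v ∈ cluster ends ω₂ w
      · rw [if_pos ⟨hω₂, hvY⟩]
        unfold typedCount
        simp only [withC_empty]
        have hsum := sum_onS_union hd3 (fun ω => wt ends s w ω *
          dlt (star w F (cluster ends ω₂ w)) (star w G (cluster ends ω₂ w)) (cluster ends ω s)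
            (cluster ends (flipOn (S₁ ∪ {e₀}) ω) s))
        rw [hsum]
        refine Finset.sum_congr rfl fun ω₁ _ => ?_
        by_cases hω₁ : OnS S₁ ω₁
        · rw [if_pos hω₁, if_pos hω₁, sum_onS_singleton]
          have hY₁ : OnS S₁ (flipOn S₁ ω₁) := onS_flipOn S₁ ω₁
          have hC₁ : cluster ends ω₁ s ⊆ V₁ :=
            cluster_subset_of_edges_in hs fun e he x hx => h₁ e (hω₁ e he) x hx
          have hC₁' : cluster ends (flipOn S₁ ω₁) s ⊆ V₁ :=
            cluster_subset_of_edges_in hs fun e he x hx => h₁ e (hY₁ e he) x hx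
          have hwR : w ∉ cluster ends ω₁ s := fun h => hw (hC₁ h)
          have hwB : w ∉ cluster ends (flipOn S₁ ω₁) s := fun h => hw (hC₁' h)
          have hred1 : cluster ends (join ω₁ (one e₀)) s =
              cluster ends ω₁ s ∪ (if u ∈ cluster ends ω₁ s then {u, w} else ∅) := by
            rw [cluster_join_pendant hs hu h₁ h₂'' hω₁ (onS_one e₀), cluster_one he₀]
          have hred0 : cluster ends (join ω₁ (fun _ => false)) s = cluster ends ω₁ s := by
            rw [cluster_join_pendant hs hu h₁ h₂'' hω₁ h0, cluster_zero]
            by_cases huR : u ∈ cluster ends ω₁ s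
            · rw [if_pos huR]
              exact Set.union_eq_self_of_subset_right (Set.singleton_subset_iff.2 huR)
            · rw [if_neg huR, Set.union_empty]
          have hblue1 : cluster ends (flipOn (S₁ ∪ {e₀}) (join ω₁ (one e₀))) s =
              cluster ends (flipOn S₁ ω₁) s := by
            rw [flipOn_union_join hd3 hω₁ (onS_one e₀), flipOn_singleton_one,
              cluster_join_pendant hs hu h₁ h₂'' hY₁ h0, cluster_zero]
            by_cases huB : u ∈ cluster ends (flipOn S₁ ω₁) s
            · rw [if_pos huB]
              exact Set.union_eq_self_of_subset_right (Set.singleton_subset_iff.2 huB)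
            · rw [if_neg huB, Set.union_empty]
          -- the closed term vanishes
          have hnot0 : w ∉ cluster ends (join ω₁ (fun _ => false)) s := by
            rw [hred0]; exact hwR
          have hterm0 : (wt ends s w (join ω₁ (fun _ => false)) : R) = 0 := by
            unfold wt; rw [if_neg hnot0]
          rw [hterm0, zero_mul, add_zero]
          simp only [core]
          by_cases huR : u ∈ cluster ends ω₁ s
          · rw [if_pos ⟨huR, hvY⟩]
            rw [if_pos huR] at hred1
            have hmem : w ∈ cluster ends (join ω₁ (one e₀)) s := by
              rw [hred1]; exact Or.inr (Or.inr rfl)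
            have hwt : (wt ends s w (join ω₁ (one e₀)) : R) = 1 := by
              unfold wt; rw [if_pos hmem]
            rw [hwt, one_mul, hred1, hblue1]
            unfold dlt star
            have hmem' : w ∈ cluster ends ω₁ s ∪ {u, w} := Or.inr (Or.inr rfl)
            simp only [if_pos hmem', if_neg hwB]
            have hset : (cluster ends ω₁ s ∪ {u, w}) \ {w} ∪ cluster ends ω₂ w =
                cluster ends ω₁ s ∪ cluster ends ω₂ w := by
              ext x
              simp only [Set.mem_union, Set.mem_sdiff, Set.mem_insert_iff, Set.mem_singleton_iff]
              constructor
              · rintro (⟨hx | hx | hx, _⟩ | hx)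
                · exact Or.inl hx
                · subst hx; exact Or.inl huR
                · subst hx; exact Or.inr hwY
                · exact Or.inr hx
              · rintro (hx | hx)
                · exact Or.inl ⟨Or.inl hx, fun h => hwR (h ▸ hx)⟩
                · exact Or.inr hx
            rw [hset]
          · rw [if_neg (fun h => huR h.1)]
            rw [if_neg huR, Set.union_empty] at hred1
            have hmem : w ∉ cluster ends (join ω₁ (one e₀)) s := by
              rw [hred1]; exact hwR
            have hwt : (wt ends s w (join ω₁ (one e₀)) : R) = 0 := by
              unfold wt; rw [if_neg hmem]
            rw [hwt, zero_mul]
        · rw [if_neg hω₁, if_neg hω₁]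
      · rw [if_neg (fun h => hvY h.2)]
        symm
        apply Finset.sum_eq_zero
        intro ω₁ _
        simp only [core]
        split_ifs with h1 h2
        · exact absurd h2.2 hvY
        · rfl
        · rfl
    · rw [if_neg (fun h => hω₂ h.1), if_neg hω₂]
  rw [hL, hR]
  -- swap the order of summation
  have step : ∀ ω₂ : Config E, (if OnS S₂ ω₂ then
      ∑ ω₁ : Config E, (if OnS S₁ ω₁ then core ω₁ ω₂ else 0) else 0) =
      ∑ ω₁ : Config E, (if OnS S₁ ω₁ then (if OnS S₂ ω₂ then core ω₁ ω₂ else 0) else 0) := by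
    intro ω₂
    by_cases h2 : OnS S₂ ω₂
    · simp [h2]
    · simp [h2]
  simp_rw [step]
  rw [Finset.sum_comm]
  refine Finset.sum_congr rfl fun ω₁ _ => ?_
  by_cases h1 : OnS S₁ ω₁
  · simp [h1]
  · simp [h1]

end Bridge

end TypedDeletion

end Summit.Ventures.PercRepro2
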